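import Literature.Analysis.FluidPDE.TaoCascadeOfSingleScale
import Literature.Analysis.FluidPDE.TaoAveragedBetaForm
import Literature.Analysis.FluidPDE.TaoAveragedRhoSymbol
import Literature.Analysis.FluidPDE.TaoAveragedCascadeStepsProofs
import Literature.Analysis.FluidPDE.TaoAveragedCascadeHolds
import HarnessLib

/-!
# Tao 2016, §3.2 ¶3–§3.4 WITHOUT dilation operators, and the dilation-free complex average at the
# normalisation (3.7)

T. Tao, *Finite time blowup for an averaged three-dimensional Navier–Stokes equation*, J. Amer. Math.
Soc. **29** (2016), 601–674 = arXiv:1402.0290v3, §3.2 ¶3 (transitivity), §3.3 (`B_η`, `B_{η,ρ}`),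
§3.4 (single frequency scale), §3.5–3.9 ((3.9) "without the use of dilation operators"), Remark 3.5
p. 20 ("The averaging over dilation operators was only needed to place the base frequencies
`ξ⁰₁, ξ⁰₂, ξ⁰₃` in a location where the non-degeneracy condition (c-nondeg) held").
HONEST FRAMING (cell harvest/h2-tao-ladder, TAO-LADDER rung M_1; MODEL statements about Tao's
averaged equation): this file makes Remark 3.5's first sentence a KERNEL statement at the
normalisation (3.7): every step of Tao's §3.2 ¶3–§3.9 except the normalisation of the base frequencies
(§3.2 ¶2) is dilation-free. It does NOT prove the cell's crux R1-a (which needs the same chain at a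
GENERAL admissible base triple) and says nothing about the true Navier–Stokes equations.

The tree proves the six steps of `TaoAveragedCascadeSteps.lean` with NAMED data whose dilation
factors are read off here: `ComplexAveragingDatum.comp` (`λ = λ₁·λ₂`), `ComplexAveragingDatum.singleScale`
and `.scale` (`λ ≡ 1`, §3.4), `betaDatum` (`λ ≡ 1`, §3.3), `rhoDatum` (`λ ≡ 1`, §3.3 last paragraph).
Hence, with `IsComplexAverageNoDilOf` (`TaoAveragedCascadeReduction.lean`):
* `IsComplexAverageNoDilOf.trans_eulerForm` — §3.2 ¶3 transitivity towards `B`, dilation-free;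
* `cascade_of_singleScale_noDil`, `betaForm_isComplexAverageNoDil`, `betaRhoForm_isComplexAverageNoDil`
  — steps §3.4, §3.3, §3.3-last with `λ ≡ 1`;
* `normalised_isComplexAverageNoDil` — **for `ε₀ ≤ 1/100` and profiles normalised about Tao's base
  triple (3.7), the complexified basic cascade operator `C` is a DILATION-FREE complex average of the
  Euler form `B`** (steps 1–4, 6 composed as in `normalised_isComplexAverage_of_steps`, with the
  tree's `singleScale_isComplexAverageNoDil_holds` for step 1). The only place where Tao's Theorem 3.2
  uses dilation averaging is therefore `basicCascade_of_normalised` (§3.2 ¶2: moving arbitrary base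
  frequencies to (3.7)).
Theorems only.

## References

* T. Tao, J. Amer. Math. Soc. 29 (2016), 601–674 = arXiv:1402.0290v3, §3.2–§3.4 pp. 15–17, §3.5–3.9,
  Remark 3.5 p. 20. [`Tao2016AveragedNS`]
-/

noncomputable section

open MeasureTheory Set Filter
open scoped SchwartzMap

namespace Literature.Analysis.FluidPDE.Tao2016

/-- **§3.2 ¶3 without dilations: transitivity towards `B`.** If `C₁` is a dilation-free complex
average of `C₂` and `C₂` a dilation-free complex average of `B`, then `C₁` is a dilation-free complex
average of `B` (the composed datum `𝒟₁.comp 𝒟₂` has dilation factors `λ₁·λ₂ = 1`).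
[cite: Tao2016AveragedNS, §3.2 p. 16] -/
theorem IsComplexAverageNoDilOf.trans_eulerForm {C₁ C₂ : L2C → L2C → L2C → ℂ}
    (h₁ : IsComplexAverageNoDilOf C₁ C₂) (h₂ : IsComplexAverageNoDilOf C₂ eulerForm) :
    IsComplexAverageNoDilOf C₁ eulerForm := by
  obtain ⟨𝒟₁, hlam₁, h₁⟩ := h₁
  obtain ⟨𝒟₂, hlam₂, h₂⟩ := h₂
  refine ⟨𝒟₁.comp 𝒟₂, fun i θ => ?_, fun u v w hu hv hw => ?_⟩
  · change 𝒟₁.lam i θ.1 * 𝒟₂.lam i θ.2 = 1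
    rw [hlam₁, hlam₂, one_mul]
  · rw [h₁ u v w hu hv hw, 𝒟₁.comp_average_eulerForm 𝒟₂ hu.1 hv.1 w]
    change ∫ θ, C₂ (𝒟₁.slot 0 θ u) (𝒟₁.slot 1 θ v) (𝒟₁.slot 2 θ w) ∂𝒟₁.μ = _
    refine integral_congr_ae (Eventually.of_forall fun θ => ?_)
    exact h₂ _ _ _ (𝒟₁.memH10dfC_slot 0 θ hu) (𝒟₁.memH10dfC_slot 1 θ hv)
      (𝒟₁.memH10dfC_slot 2 θ hw)

/-- **§3.4 without dilations**: for `0 < ε₀ ≤ 1/100` and normalised profiles, if `C₀` is a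
dilation-free complex average of `B_{η,ρ,0}` then the complexified basic cascade operator `C` is a
DILATION-FREE complex average of `B_{η,ρ}` (the tree's datum `(𝒟.singleScale ε₀).scale (-πi)⁻¹` has
`λ ≡ 1`). [cite: Tao2016AveragedNS, §3.4 pp. 16–17] -/
theorem cascade_of_singleScale_noDil {ε₀ : ℝ} (hε : 0 < ε₀) (hε1 : ε₀ ≤ 1 / 100)
    {ψ : Fin 3 → 𝓢(EuclideanSpace ℝ (Fin 3), EuclideanSpace ℂ (Fin 3))} (hψ : NormalisedProfiles ε₀ ψ)
    (hC₀ : IsComplexAverageNoDilOf (singleScaleForm (ψ 0) (ψ 1) (ψ 2)) (betaRhoZeroForm ε₀)) :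
    IsComplexAverageNoDilOf (cplxBasicCascadeForm ε₀ (ψ 0) (ψ 1) (ψ 2)) (betaRhoForm ε₀) := by
  obtain ⟨𝒟, hlam, h𝒟⟩ := hC₀
  exact ⟨(𝒟.singleScale ε₀ hε hε1).scale (-(Real.pi * Complex.I))⁻¹, fun _ _ => rfl,
    fun u v w hu hv hw => 𝒟.cplxBasicCascadeForm_eq_average hlam hε hε1 hψ h𝒟 hu hv hw⟩

/-- **§3.3 without dilations**: for `0 < ε₀ ≤ 1/5` the frequency-comparable form `B_η` is a
DILATION-FREE complex average of `B` (the tree's `betaDatum` — imaginary-order multipliers `D^{it}` —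
has `λ ≡ 1`). [cite: Tao2016AveragedNS, §3.3 p. 16] -/
theorem betaForm_isComplexAverageNoDil {ε₀ : ℝ} (hε : 0 < ε₀) (hε' : ε₀ ≤ 1 / 5) :
    IsComplexAverageNoDilOf (betaForm ε₀) eulerForm :=
  ⟨betaDatum hε hε', fun _ _ => rfl, fun _ _ w hu hv _ =>
    (betaDatum_average_eulerForm hε hε' w hu.1 hv.1).symm⟩

/-- **§3.3, last paragraph, without dilations**: for `0 < ε₀ ≤ 1/5`, `B_{η,ρ}` is a DILATION-FREE
complex average of `B_η` (the one-point datum `rhoDatum` with `m₁ = ρ` has `λ ≡ 1`).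
[cite: Tao2016AveragedNS, §3.3 p. 16] -/
theorem betaRhoForm_isComplexAverageNoDil {ε₀ : ℝ} (hε : 0 < ε₀) (hε' : ε₀ ≤ 1 / 5) :
    IsComplexAverageNoDilOf (betaRhoForm ε₀) (betaForm ε₀) := by
  refine ⟨rhoDatum hε hε', fun _ _ => rfl, fun u v w _ _ _ => ?_⟩
  rw [rhoDatum_average, rhoDatum_slot_zero,
    rhoDatum_slot_of_ne_zero hε hε' (show (1 : Fin 3) ≠ 0 by decide),
    rhoDatum_slot_of_ne_zero hε hε' (show (2 : Fin 3) ≠ 0 by decide), betaForm_rhoMultiplier]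
  · exact hε
  · exact hε'

/-- **At Tao's normalisation (3.7) the whole chain §3.3–§3.9 is dilation-free**: there is an absolute
`ε₁ > 0` such that for `0 < ε₀ ≤ ε₁` and profiles `ψⱼ` with `ψ̂ⱼ ⊆ B(ξⱼ⁰, ε₀³)`, the complexified basic
cascade operator `C` (3.6) is a DILATION-FREE complex average of the Euler form `B` — (3.9) at `xi0`
(`singleScale_isComplexAverageNoDil_holds`), §3.4, §3.3 and transitivity, each with `λ ≡ 1`. The only
use of dilation averaging in Theorem 3.2 is thus the normalisation of the base frequencies (§3.2 ¶2;
Remark 3.5). [cite: Tao2016AveragedNS, §3.2–3.9, Remark 3.5 p. 20] -/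
theorem normalised_isComplexAverageNoDil :
    ∃ ε₁ : ℝ, 0 < ε₁ ∧ ∀ ε₀ : ℝ, 0 < ε₀ → ε₀ ≤ ε₁ →
      ∀ ψ : Fin 3 → 𝓢(EuclideanSpace ℝ (Fin 3), EuclideanSpace ℂ (Fin 3)), NormalisedProfiles ε₀ ψ →
        IsComplexAverageNoDilOf (cplxBasicCascadeForm ε₀ (ψ 0) (ψ 1) (ψ 2)) eulerForm := by
  obtain ⟨e₁, he₁, h₁⟩ := singleScale_isComplexAverageNoDil_holds
  refine ⟨min e₁ (1 / 100), lt_min he₁ (by norm_num), fun ε₀ hε₀ hle ψ hψ => ?_⟩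
  have hle₁ : ε₀ ≤ e₁ := hle.trans (min_le_left _ _)
  have hle₂ : ε₀ ≤ 1 / 100 := hle.trans (min_le_right _ _)
  have hle₅ : ε₀ ≤ 1 / 5 := hle₂.trans (by norm_num)
  have hC : IsComplexAverageNoDilOf (cplxBasicCascadeForm ε₀ (ψ 0) (ψ 1) (ψ 2)) (betaRhoForm ε₀) :=
    cascade_of_singleScale_noDil hε₀ hle₂ hψ (h₁ ε₀ hε₀ hle₁ ψ hψ)
  have hBrho : IsComplexAverageNoDilOf (betaRhoForm ε₀) eulerForm :=
    (betaRhoForm_isComplexAverageNoDil hε₀ hle₅).trans_eulerForm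
      (betaForm_isComplexAverageNoDil hε₀ hle₅)
  exact hC.trans_eulerForm hBrho

end Literature.Analysis.FluidPDE.Tao2016
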